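import Literature.RingTheory.Nullstellensatz.EffectiveNullstellensatz
import Literature.RingTheory.MvPolynomial.OstrowskiNorms
import Literature.RingTheory.MvPolynomial.OstrowskiIntegerCramer
import HarnessLib

/-!
# Bézout identities as linear systems; an integer Nullstellensatz certificate with a height bound

Support file for the proof of Ostrowski's theorem
(`Literature.RingTheory.MvPolynomial.ostrowski1919_absIrreducible_reduction`, Schmidt, *Equations
over finite fields*, Ch. V, Cor. 2B) along the Nullstellensatz-certificate line. Where Schmidt
(proof of Thm. 2A) eliminates the unknown factor `g` by the resultant system of his Thm. 1A, this
line uses the tree's effective Nullstellensatz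
(`Literature.RingTheory.Nullstellensatz.exists_sum_mul_eq_one_of_forall_exists_ne_zero`, after
Jelonek 2005): integer polynomials `P_i ∈ ℤ[σ]` without common zero over an algebraically closed
field of characteristic `0` satisfy `∑ g_i P_i = 1` over `ℚ` with `deg g_i ≤ D`; this is a linear
system with integer coefficients in the coefficients of the `g_i`, so (integer Cramer rule,
`OstrowskiIntegerCramer.lean`) `∑ G_i P_i = Γ` with `G_i ∈ ℤ[σ]` and an integer
`0 < |Γ| ≤ X! · A^X`, `X` the number of unknowns and `A ≥ ‖P_i‖` — an identity that survives
reduction modulo every prime `p ∤ Γ` (`exists_int_certificate`).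

## Contents ([folklore])

* `boxExp` — exponents in a box `{0, …, D}^σ` indexed by `σ → Fin (D + 1)`; `eq_sum_boxExp`;
* `sysMatrix P D E` — the matrix of `(G_i)_i ↦ ∑ G_i P_i` on box monomials, `sysMatrix_mulVec`,
  the two translations `sysMatrix_mulVec_coeff_eq` / `sum_mul_eq_C_of_sysMatrix_mulVec`,
  `sysMatrix_map`, `natAbs_sysMatrix_le`;
* `exists_sum_mul_eq_one_of_forall_exists_aeval_ne_zero` — the effective Nullstellensatz for
  arbitrary finite index types;
* `exists_int_certificate` — the integer certificate with height bound.

## References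

* W. M. Schmidt, *Equations over finite fields. An elementary approach*, LNM 536 (1976), 2nd ed.
  (2004), Ch. V §2 (Thm. 2A, Cor. 2B). [`Schmidt1976`]
* Z. Jelonek, *On the effective Nullstellensatz*, Invent. Math. 162 (2005), Thm. 1.1.
  [`Jelonek2005`]
-/

noncomputable section

open MvPolynomial

namespace Literature.RingTheory.MvPolynomial

/-! ### Box exponents -/

section Box

variable {σ : Type*} [Fintype σ] {D : ℕ}

/-- The exponent `μ ∈ {0, …, D}^σ` given by `μ : σ → Fin (D + 1)`. [folklore] -/
def boxExp (μ : σ → Fin (D + 1)) : σ →₀ ℕ :=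
  Finsupp.equivFunOnFinite.symm fun i => (μ i : ℕ)

/-- Components of a box exponent. [folklore] -/
@[simp] theorem boxExp_apply (μ : σ → Fin (D + 1)) (i : σ) : boxExp μ i = μ i := by
  simp [boxExp]

/-- `boxExp` is injective. [folklore] -/
theorem boxExp_injective : Function.Injective (boxExp (σ := σ) (D := D)) := fun μ ν h =>
  funext fun i => Fin.ext (by simpa using congr_arg (fun m : σ →₀ ℕ => m i) h)

/-- The zero exponent. [folklore] -/
@[simp] theorem boxExp_zero : boxExp (0 : σ → Fin (D + 1)) = 0 := by
  ext i
  simp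

/-- `boxExp μ = 0` iff `μ = 0`. [folklore] -/
theorem boxExp_eq_zero_iff {μ : σ → Fin (D + 1)} : boxExp μ = 0 ↔ μ = 0 := by
  rw [← boxExp_zero]
  exact boxExp_injective.eq_iff

/-- Box exponents are bounded by `D`. [folklore] -/
theorem boxExp_le (μ : σ → Fin (D + 1)) (i : σ) : boxExp μ i ≤ D := by
  rw [boxExp_apply]
  exact Nat.le_of_lt_succ (μ i).2

/-- Every exponent bounded by `D` is a box exponent. [folklore] -/
theorem exists_boxExp_eq (m : σ →₀ ℕ) (h : ∀ i, m i ≤ D) :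
    ∃ μ : σ → Fin (D + 1), boxExp μ = m :=
  ⟨fun i => ⟨m i, Nat.lt_succ_of_le (h i)⟩, by ext i; simp⟩

variable [DecidableEq σ]

/-- A polynomial of total degree `≤ D` is the sum of its terms over the box `{0, …, D}^σ`.
[folklore] -/
theorem eq_sum_boxExp {R : Type*} [CommSemiring R] (g : MvPolynomial σ R) (hg : g.totalDegree ≤ D) :
    g = ∑ μ : σ → Fin (D + 1), coeff (boxExp μ) g • monomial (boxExp μ) (1 : R) := by
  classical
  ext m
  rw [coeff_sum]
  simp only [coeff_smul, coeff_monomial, smul_eq_mul, mul_ite, mul_one, mul_zero]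
  by_cases h : ∀ i, m i ≤ D
  · obtain ⟨μ₀, hμ₀⟩ := exists_boxExp_eq m h
    rw [Finset.sum_eq_single μ₀]
    · rw [if_pos hμ₀, hμ₀]
    · intro μ _ hne
      rw [if_neg]
      intro heq
      exact hne (boxExp_injective (heq.trans hμ₀.symm))
    · simp
  · have hcoeff : coeff m g = 0 := by
      by_contra hne
      apply h
      intro i
      have h1 : m i ≤ m.sum fun _ e => e := Finsupp.le_degree i m
      have h2 : (m.sum fun _ e => e) ≤ g.totalDegree := le_totalDegree (mem_support_iff.2 hne)
      omega
    rw [hcoeff]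
    refine (Finset.sum_eq_zero fun μ _ => ?_).symm
    split_ifs with hμ
    · rw [hμ, hcoeff]
    · rfl

end Box

/-! ### The linear system of a Bézout identity -/

section Sys

variable {S : Type*} [CommRing S] {σ ι : Type*} [Fintype σ] [DecidableEq σ] [Fintype ι]

/-- The matrix of the `S`-linear map `(G_i)_i ↦ ∑ G_i P_i`, from the coefficients of the `G_i`
on the box monomials of exponent `≤ D` to the coefficients on the box monomials of exponent
`≤ D + E`. [folklore] -/
def sysMatrix (P : ι → MvPolynomial σ S) (D E : ℕ) :
    Matrix (σ → Fin (D + E + 1)) (ι × (σ → Fin (D + 1))) S :=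
  fun ν c => coeff (boxExp ν) (monomial (boxExp c.2) 1 * P c.1)

/-- `sysMatrix P · z` lists the box coefficients of `∑_{(i, μ)} z_{i, μ} X^μ P_i`. [folklore] -/
theorem sysMatrix_mulVec (P : ι → MvPolynomial σ S) (D E : ℕ) (z : ι × (σ → Fin (D + 1)) → S)
    (ν : σ → Fin (D + E + 1)) :
    (sysMatrix P D E).mulVec z ν =
      coeff (boxExp ν) (∑ c : ι × (σ → Fin (D + 1)), z c • (monomial (boxExp c.2) 1 * P c.1)) := by
  rw [Matrix.mulVec, dotProduct, coeff_sum]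
  refine Finset.sum_congr rfl fun c _ => ?_
  rw [coeff_smul, smul_eq_mul, mul_comm]
  rfl

/-- Regrouping `∑_i (∑_μ z_{i,μ} X^μ) P_i = ∑_{(i,μ)} z_{i,μ} X^μ P_i`. [folklore] -/
theorem sum_sum_smul_monomial_mul (P : ι → MvPolynomial σ S) (D : ℕ)
    (z : ι × (σ → Fin (D + 1)) → S) :
    ∑ i, (∑ μ : σ → Fin (D + 1), z (i, μ) • monomial (boxExp μ) (1 : S)) * P i =
      ∑ c : ι × (σ → Fin (D + 1)), z c • (monomial (boxExp c.2) 1 * P c.1) := by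
  rw [Fintype.sum_prod_type]
  refine Finset.sum_congr rfl fun i _ => ?_
  rw [Finset.sum_mul]
  refine Finset.sum_congr rfl fun μ _ => ?_
  rw [smul_mul_assoc]

/-- **From a Bézout identity to the linear system**: if `∑ g_i P_i = c₀` with `deg g_i ≤ D` then
the box coefficients of the `g_i` solve `sysMatrix P · y = c₀ e₀`. [folklore] -/
theorem sysMatrix_mulVec_coeff_eq (P : ι → MvPolynomial σ S) (D E : ℕ) (g : ι → MvPolynomial σ S)
    (hg : ∀ i, (g i).totalDegree ≤ D) (c₀ : S) (h : ∑ i, g i * P i = C c₀) :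
    (sysMatrix P D E).mulVec (fun c => coeff (boxExp c.2) (g c.1)) =
      fun ν => if ν = 0 then c₀ else 0 := by
  funext ν
  rw [sysMatrix_mulVec]
  have hsum : ∑ c : ι × (σ → Fin (D + 1)),
      coeff (boxExp c.2) (g c.1) • (monomial (boxExp c.2) 1 * P c.1) = ∑ i, g i * P i := by
    rw [← sum_sum_smul_monomial_mul]
    refine Finset.sum_congr rfl fun i _ => ?_
    rw [← eq_sum_boxExp (g i) (hg i)]
  rw [hsum, h, coeff_C]
  by_cases hν : ν = 0
  · rw [if_pos hν, if_pos (by rw [hν, boxExp_zero])]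
  · rw [if_neg hν, if_neg (fun h0 => hν (boxExp_eq_zero_iff.1 h0.symm))]

/-- **From the linear system back to a Bézout identity**: if the exponents of the `P_i` are
`≤ E` entrywise and `sysMatrix P · z = Γ e₀`, then `∑ G_i P_i = Γ` with
`G_i = ∑_μ z_{i,μ} X^μ`. [folklore] -/
theorem sum_mul_eq_C_of_sysMatrix_mulVec (P : ι → MvPolynomial σ S) (D E : ℕ)
    (hP : ∀ i, ∀ m ∈ (P i).support, ∀ t, m t ≤ E) (z : ι × (σ → Fin (D + 1)) → S) (Γ : S)
    (hz : (sysMatrix P D E).mulVec z = fun ν => if ν = 0 then Γ else 0) :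
    ∑ i, (∑ μ : σ → Fin (D + 1), z (i, μ) • monomial (boxExp μ) (1 : S)) * P i = C Γ := by
  classical
  rw [sum_sum_smul_monomial_mul]
  ext m
  by_cases hm : ∀ t, m t ≤ D + E
  · obtain ⟨ν, hν⟩ := exists_boxExp_eq m hm
    rw [← hν, ← sysMatrix_mulVec, hz, coeff_C]
    dsimp only
    by_cases h0 : ν = 0
    · rw [if_pos h0, if_pos (by rw [h0, boxExp_zero])]
    · rw [if_neg h0, if_neg (fun h0' => h0 (boxExp_eq_zero_iff.1 h0'.symm))]
  · -- outside the box both sides vanish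
    rw [coeff_C, if_neg (fun h0 => hm fun t => by rw [← h0]; simp), coeff_sum]
    refine Finset.sum_eq_zero fun c _ => ?_
    rw [coeff_smul, coeff_monomial_mul']
    split_ifs with hle
    · have hc : coeff (m - boxExp c.2) (P c.1) = 0 := by
        by_contra hne
        apply hm
        intro t
        have h1 := hP c.1 _ (mem_support_iff.2 hne) t
        have h2 := boxExp_le c.2 t
        have h3 : (m - boxExp c.2) t = m t - boxExp c.2 t := Finsupp.tsub_apply _ _ _
        have h4 := hle t
        omega
      simp [hc]
    · simp

omit [DecidableEq σ] [Fintype ι] in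
/-- `sysMatrix` commutes with ring maps of the coefficients. [folklore] -/
theorem sysMatrix_map {S' : Type*} [CommRing S'] (φ : S →+* S') (P : ι → MvPolynomial σ S)
    (D E : ℕ) : (sysMatrix P D E).map φ = sysMatrix (fun i => map φ (P i)) D E := by
  ext ν c
  simp only [sysMatrix, Matrix.map_apply]
  rw [← coeff_map, map_mul, map_monomial, map_one]

omit [DecidableEq σ] [Fintype ι] in
/-- The entries of `sysMatrix P` are coefficients of the `P_i`, bounded by `max ‖P_i‖`.
[folklore] -/
theorem natAbs_sysMatrix_le (P : ι → MvPolynomial σ ℤ) (D E A : ℕ) (hA : ∀ i, l1Norm (P i) ≤ A)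
    (ν : σ → Fin (D + E + 1)) (c : ι × (σ → Fin (D + 1))) :
    (sysMatrix P D E ν c).natAbs ≤ A := by
  simp only [sysMatrix]
  rw [coeff_monomial_mul']
  split_ifs
  · rw [one_mul]
    exact (natAbs_coeff_le_l1Norm _ _).trans (hA _)
  · simp

end Sys

/-! ### The effective Nullstellensatz for arbitrary finite index types -/

section NSS

variable {k : Type*} [Field k] [Infinite k] {K : Type*} [Field K] [Algebra k K] [IsAlgClosed K]
  {ι σ : Type*} [Fintype ι] [Fintype σ]

/-- The tree's effective Nullstellensatz
(`Literature.RingTheory.Nullstellensatz.exists_sum_mul_eq_one_of_forall_exists_ne_zero`, after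
Jelonek 2005, Thm. 1.1, weak form) transported to arbitrary finite index types: if
`P_i ∈ k[σ]` (`k` infinite, `deg P_i ≤ δ`) have no common zero over the algebraically closed
`K ⊇ k`, then `∑ g_i P_i = 1` with `deg g_i ≤ effNSBound #σ δ`. [cite: Jelonek2005, Thm. 1.1 (weak form)] -/
theorem exists_sum_mul_eq_one_of_forall_exists_aeval_ne_zero (P : ι → MvPolynomial σ k) {δ : ℕ}
    (hd : ∀ i, (P i).totalDegree ≤ δ) (hV : ∀ x : σ → K, ∃ i, aeval x (P i) ≠ 0) :
    ∃ g : ι → MvPolynomial σ k, ∑ i, g i * P i = 1 ∧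
      ∀ i, (g i).totalDegree ≤ Nullstellensatz.effNSBound (Fintype.card σ) δ := by
  classical
  set eσ := Fintype.equivFin σ with heσ
  set eι := Fintype.equivFin ι with heι
  set P' : Fin (Fintype.card ι) → MvPolynomial (Fin (Fintype.card σ)) k :=
    fun i => rename eσ (P (eι.symm i)) with hP'
  have hd' : ∀ i, (P' i).totalDegree ≤ δ := fun i => (totalDegree_rename_le _ _).trans (hd _)
  have hV' : ∀ x : Fin (Fintype.card σ) → K, ∃ i, aeval x (P' i) ≠ 0 := by
    intro x
    obtain ⟨i, hi⟩ := hV (x ∘ eσ)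
    refine ⟨eι i, ?_⟩
    simp only [hP', aeval_rename, Equiv.symm_apply_apply]
    exact hi
  obtain ⟨g', hg', hdeg'⟩ :=
    Literature.RingTheory.Nullstellensatz.exists_sum_mul_eq_one_of_forall_exists_ne_zero
      (K := K) P' hd' hV'
  refine ⟨fun i => rename eσ.symm (g' (eι i)), ?_,
    fun i => (totalDegree_rename_le _ _).trans (hdeg' _)⟩
  have h1 : ∀ i, P i = rename eσ.symm (P' (eι i)) := fun i => by
    simp only [hP', rename_rename, Equiv.symm_apply_apply, Equiv.symm_comp_self, rename_id,
      AlgHom.id_apply]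
  calc ∑ i, rename eσ.symm (g' (eι i)) * P i
      = ∑ i, rename eσ.symm (g' (eι i) * P' (eι i)) := by
        refine Finset.sum_congr rfl fun i _ => ?_
        rw [map_mul, ← h1]
    _ = rename eσ.symm (∑ i', g' i' * P' i') := by
        rw [map_sum, Equiv.sum_comp eι (fun i' => rename eσ.symm (g' i' * P' i'))]
    _ = 1 := by rw [hg', map_one]

end NSS

/-! ### The integer certificate -/

section Certificate

/-- `deg (map φ p) ≤ deg p`. [folklore] -/
theorem totalDegree_map_le_totalDegree {R R' τ : Type*} [CommSemiring R] [CommSemiring R']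
    (φ : R →+* R') (p : MvPolynomial τ R) : (map φ p).totalDegree ≤ p.totalDegree :=
  Finset.sup_mono (support_map_subset φ p)

variable {K : Type*} [Field K] [Algebra ℚ K] [IsAlgClosed K] {ι σ : Type*} [Fintype ι]
  [Fintype σ] [DecidableEq σ]

/-- **Integer Nullstellensatz certificate with a height bound.** Let `P_i ∈ ℤ[σ]` (`i ∈ ι`) have
total degree `≤ δ`, exponents `≤ E` entrywise and norm `‖P_i‖ ≤ A` (`A ≥ 1`), and no common zero
over an algebraically closed field `K` of characteristic `0`. Then `∑ G_i P_i = Γ` for some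
`G_i ∈ ℤ[σ]` and an integer `Γ` with `0 < |Γ| ≤ X! · A^X`, where `X = #ι · (D + 1)^{#σ}`,
`D = effNSBound #σ δ`. (Effective Nullstellensatz over `ℚ`, then the integer Cramer rule on the
linear system of the Bézout identity.) [folklore] -/
theorem exists_int_certificate (P : ι → MvPolynomial σ ℤ) {δ E A : ℕ}
    (hδ : ∀ i, (P i).totalDegree ≤ δ) (hE : ∀ i, ∀ m ∈ (P i).support, ∀ t, m t ≤ E)
    (hA1 : 1 ≤ A) (hA : ∀ i, l1Norm (P i) ≤ A)
    (hV : ∀ x : σ → K, ∃ i, aeval x (map (Int.castRingHom ℚ) (P i)) ≠ 0) :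
    ∃ (G : ι → MvPolynomial σ ℤ) (Γ : ℤ), Γ ≠ 0 ∧
      Γ.natAbs ≤ (Fintype.card ι *
          (Nullstellensatz.effNSBound (Fintype.card σ) δ + 1) ^ Fintype.card σ).factorial *
        A ^ (Fintype.card ι *
          (Nullstellensatz.effNSBound (Fintype.card σ) δ + 1) ^ Fintype.card σ) ∧
      ∑ i, G i * P i = C Γ := by
  classical
  set D := Nullstellensatz.effNSBound (Fintype.card σ) δ with hD
  set PQ : ι → MvPolynomial σ ℚ := fun i => map (Int.castRingHom ℚ) (P i) with hPQ
  -- the Bézout identity over `ℚ`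
  obtain ⟨g, hg, hdeg⟩ := exists_sum_mul_eq_one_of_forall_exists_aeval_ne_zero (K := K) PQ
    (δ := δ) (fun i => (totalDegree_map_le_totalDegree _ _).trans (hδ i)) hV
  -- as a solution over `ℚ` of the integer linear system
  have hsol := sysMatrix_mulVec_coeff_eq PQ D E g hdeg 1 (by rw [hg, C_1])
  have hmap : (sysMatrix P D E).map (Int.cast : ℤ → ℚ) = sysMatrix PQ D E :=
    sysMatrix_map (Int.castRingHom ℚ) P D E
  rw [← hmap] at hsol
  set b : (σ → Fin (D + E + 1)) → ℤ := fun ν => if ν = 0 then 1 else 0 with hb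
  have hsol' : ((sysMatrix P D E).map (Int.cast : ℤ → ℚ)).mulVec
      (fun c => coeff (boxExp c.2) (g c.1)) = fun ν => (b ν : ℚ) := by
    rw [hsol]
    funext ν
    simp [hb]
  obtain ⟨z, Γ, hΓ0, hΓle, hz⟩ := exists_int_mulVec_eq_smul (sysMatrix P D E) b A hA1
    (natAbs_sysMatrix_le P D E A hA) _ hsol'
  refine ⟨fun i => ∑ μ : σ → Fin (D + 1), z (i, μ) • monomial (boxExp μ) (1 : ℤ), Γ, hΓ0, ?_, ?_⟩
  · simpa [Fintype.card_prod, Fintype.card_fun, Fintype.card_fin] using hΓle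
  · refine sum_mul_eq_C_of_sysMatrix_mulVec P D E hE z Γ ?_
    rw [hz]
    funext ν
    simp [hb]

end Certificate

end Literature.RingTheory.MvPolynomial
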